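import Summits.CriticalPhenomena.PercolationContinuityZ3.Theorems.PercNearOneGluingNoHeavyLowerTailKnQuestion8PocketPieces
import HarnessLib

/-!
# KN Question 8 at three relays, PCOV by one-edge Bernstein induction — monotonicity of the constant `τ` in the weak set (proved)

Support file (`--supports stmt-CriticalPhenomena-4575`, closed), prover `prim-hp-7` (gen 37).  No definitions, no named
facts, no sorries; standard axioms.  Memo `prim-hp-7/FROM-prim-hp-7-g37-PCOV-BERNSTEIN.md` §2, §6, §9.

Setting: `μ = prodBernoulli w` on a finite vertex type; owner `x`, observer `o`, second strong relay `y`, a set `A` of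
avoided ("weak") vertices and one more vertex `v`.  The constant of the pocket covariance comparison PCOV with weak set `W` is
`τ_W = b_W / c_W`, `b_W = μ(o ↔ y, C_y ∌ x, C_y ∩ W = ∅)`, `c_W = μ(o ↮ y, o ↮ x, y ↮ x, (C_o ∪ C_y) ∩ W = ∅)`.  Writing
`D = {{o,y} ↮ {x} ∪ A}` (no open path from `o` or `y` to `x` or into `A`) both are `D`-probabilities:
`b_A = μ(D ∩ {o↔y})`, `c_A = μ(D ∩ {o↮y})`, and `b_{A∪{v}} = μ(D ∩ {o↔y} ∩ {v ∉ C_o ∪ C_y})`,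
`c_{A∪{v}} = μ(D ∩ {o↮y} ∩ {v ∉ C_o ∪ C_y})`.  THEOREM (`PcovBern.tau_antitone`):

  `b_{A∪{v}} · c_A ≤ b_A · c_{A∪{v}}`,  i.e.  `τ_{A ∪ {v}} ≤ τ_A`

("enlarging the weak set lowers the odds that the observer and the second relay are joined").  Proof: given `D = {S ↮ T}`
with `S = {o,y}`, `T = {x} ∪ A`, the indicators of `{o ↔ y}` and of `{v ∈ C_o ∪ C_y}` are increasing functions of the edge
cluster of `S`, hence positively correlated given `D` (van den Berg–Häggström–Kahn Thm 2.1 at `q = 1`,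
`BHK2006_setClusterConditionalPositiveAssociation`); the displayed inequality is that covariance inequality rearranged.
Used in the Bernstein route at the special edge `z–x` and for the polarisation `T(1,0,0) ≥ 0` (memo §2); census 0 / 4 500
(edges at `x` and at `z`, n ≤ 7).  Not in print in this form.
[cite: VandenbergHaggstromKahn2005, Thm. 2.1 (p. 9), Remark 1 after Thm. 1.2 (p. 5), Thm. 1.3 (p. 6)]
[cite: KozmaNitzan2024, Question 8 (§5.5 p. 36)]
-/

namespace Summit.CriticalPhenomena.PercolationContinuityZ3.Theorems

open MeasureTheory Set Literature.Probability.LatticeModels Literature.Probability.Percolation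
open scoped Classical
open KNPreFKG

noncomputable section

namespace PcovBern

variable {V : Type*} [Fintype V]

/-- **`τ` is antitone in the weak set.**  With `D = {ω | ∀ s ∈ {o,y}, ∀ t ∈ insert x A, ¬ s ↔ t}`:
`μ(D ∩ {o↔y} ∩ {v ∉ C_o} ∩ {v ∉ C_y}) · μ(D ∩ {o↮y}) ≤ μ(D ∩ {o↔y}) · μ(D ∩ {o↮y} ∩ {v ∉ C_o} ∩ {v ∉ C_y})`.
Proof: positive correlation of `1{o↔y}` and `1{v ∈ C_o ∪ C_y}` (increasing in the edge cluster of `S = {o,y}`) given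
`{S ↮ T}`, `T = insert x A` (`BHK2006_setClusterConditionalPositiveAssociation`), rearranged.
[cite: VandenbergHaggstromKahn2005, Thm. 2.1 (p. 9), Remark 1 after Thm. 1.2 (p. 5)] -/
theorem tau_antitone (w : Sym2 V → unitInterval) (x o y v : V) (A : Set V) :
    (prodBernoulli w).real ({ω : BondConfig V | ∀ s ∈ ({o, y} : Set V), ∀ t ∈ insert x A, ¬ (openGraph ω).Reachable s t} ∩
          openConn o y ∩ ({ω | ¬ (openGraph ω).Reachable o v} ∩ {ω | ¬ (openGraph ω).Reachable y v})) *
      (prodBernoulli w).real ({ω : BondConfig V | ∀ s ∈ ({o, y} : Set V), ∀ t ∈ insert x A, ¬ (openGraph ω).Reachable s t} ∩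
          {ω | ¬ (openGraph ω).Reachable o y}) ≤
    (prodBernoulli w).real ({ω : BondConfig V | ∀ s ∈ ({o, y} : Set V), ∀ t ∈ insert x A, ¬ (openGraph ω).Reachable s t} ∩
          openConn o y) *
      (prodBernoulli w).real ({ω : BondConfig V | ∀ s ∈ ({o, y} : Set V), ∀ t ∈ insert x A, ¬ (openGraph ω).Reachable s t} ∩
          {ω | ¬ (openGraph ω).Reachable o y} ∩ ({ω | ¬ (openGraph ω).Reachable o v} ∩ {ω | ¬ (openGraph ω).Reachable y v})) := by
  classical
  set μ := prodBernoulli w with hμ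
  have hmeas : ∀ S' : Set (BondConfig V), MeasurableSet S' := fun _ => MeasurableSet.of_discrete
  set S : Set V := {o, y} with hS
  set T : Set V := insert x A with hT
  set D : Set (BondConfig V) := {ω : BondConfig V | ∀ s ∈ S, ∀ t ∈ T, ¬ (openGraph ω).Reachable s t} with hD
  set J : Set (BondConfig V) := openConn o y with hJ
  set W : Set (BondConfig V) := openConn o v ∪ openConn y v with hW
  -- the two increasing functions of the edge cluster of `S`
  set Fe : Set (Sym2 V) → ℝ := fun C => if y ∈ openCluster C o then (1 : ℝ) else 0 with hFe
  set Ge : Set (Sym2 V) → ℝ := fun C => if v ∈ openCluster C o ∨ v ∈ openCluster C y then (1 : ℝ) else 0 with hGe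
  have hFe_mono : Monotone Fe := by
    intro C C' hCC'
    simp only [hFe]
    by_cases h : y ∈ openCluster C o
    · rw [if_pos h, if_pos (openCluster_mono hCC' o h)]
    · rw [if_neg h]; split_ifs <;> norm_num
  have hGe_mono : Monotone Ge := by
    intro C C' hCC'
    simp only [hGe]
    by_cases h : v ∈ openCluster C o ∨ v ∈ openCluster C y
    · have h' : v ∈ openCluster C' o ∨ v ∈ openCluster C' y :=
        h.imp (fun h1 => openCluster_mono hCC' o h1) (fun h2 => openCluster_mono hCC' y h2)
      rw [if_pos h, if_pos h']
    · rw [if_neg h]; split_ifs <;> norm_num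
  have hoS : o ∈ S := by simp [hS]
  have hyS : y ∈ S := by simp [hS]
  have hclo : ∀ ω : BondConfig V, openCluster (⋃ s ∈ S, openEdgeCluster ω s) o = openCluster ω o := by
    intro ω; ext a; exact (KNSep.reachable_iff_cluster ω S hoS a).symm
  have hcly : ∀ ω : BondConfig V, openCluster (⋃ s ∈ S, openEdgeCluster ω s) y = openCluster ω y := by
    intro ω; ext a; exact (KNSep.reachable_iff_cluster ω S hyS a).symm
  have hFe_eq : ∀ ω : BondConfig V, Fe (⋃ s ∈ S, openEdgeCluster ω s) = J.indicator 1 ω := by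
    intro ω
    simp only [hFe, hclo ω]
    by_cases h : y ∈ openCluster ω o
    · rw [if_pos h, indicator_of_mem (show ω ∈ J from h)]; simp
    · rw [if_neg h, indicator_of_notMem (show ω ∉ J from h)]
  have hGe_eq : ∀ ω : BondConfig V, Ge (⋃ s ∈ S, openEdgeCluster ω s) = W.indicator 1 ω := by
    intro ω
    simp only [hGe, hclo ω, hcly ω]
    have hiff : (v ∈ openCluster ω o ∨ v ∈ openCluster ω y) ↔ ω ∈ W := by
      simp only [hW, mem_union, openConn]; exact Iff.rfl
    by_cases h : v ∈ openCluster ω o ∨ v ∈ openCluster ω y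
    · rw [if_pos h, indicator_of_mem (hiff.1 h)]; simp
    · rw [if_neg h, indicator_of_notMem (fun h' => h (hiff.2 h'))]
  have key := BHK2006_setClusterConditionalPositiveAssociation w S T Fe Ge hFe_mono hGe_mono
  have eF : ∫ ω in D, Fe (⋃ s ∈ S, openEdgeCluster ω s) ∂μ = μ.real (D ∩ J) := by
    simp_rw [hFe_eq]; rw [setIntegral_indicator_one_eq μ D J]
  have eG : ∫ ω in D, Ge (⋃ s ∈ S, openEdgeCluster ω s) ∂μ = μ.real (D ∩ W) := by
    simp_rw [hGe_eq]; rw [setIntegral_indicator_one_eq μ D W]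
  have eFG : ∫ ω in D, Fe (⋃ s ∈ S, openEdgeCluster ω s) * Ge (⋃ s ∈ S, openEdgeCluster ω s) ∂μ = μ.real (D ∩ J ∩ W) := by
    simp_rw [hFe_eq, hGe_eq]
    rw [setIntegral_mul_indicator_one μ D W (J.indicator 1), setIntegral_indicator_one_eq μ (D ∩ W) J]
    congr 1; ext ω; simp only [mem_inter_iff]; tauto
  rw [eF, eG, eFG] at key
  -- key : μ(D ∩ J) * μ(D ∩ W) ≤ μ D * μ(D ∩ J ∩ W)
  -- complements inside `D`: `{o↮y} = Jᶜ`, `{v ∉ C_o} ∩ {v ∉ C_y} = Wᶜ`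
  have hJc : {ω : BondConfig V | ¬ (openGraph ω).Reachable o y} = Jᶜ := by
    ext ω; simp [hJ, openConn]
  have hWc : ({ω : BondConfig V | ¬ (openGraph ω).Reachable o v} ∩ {ω | ¬ (openGraph ω).Reachable y v}) = Wᶜ := by
    ext ω; simp [hW, openConn, mem_inter_iff]
  have m1 : μ.real (D ∩ J ∩ Wᶜ) = μ.real (D ∩ J) - μ.real (D ∩ J ∩ W) := by
    have h := measureReal_inter_add_sdiff (μ := μ) (s := D ∩ J) (hmeas W)
    rw [Set.sdiff_eq] at h; linarith
  have m2 : μ.real (D ∩ Jᶜ) = μ.real D - μ.real (D ∩ J) := by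
    have h := measureReal_inter_add_sdiff (μ := μ) (s := D) (hmeas J)
    rw [Set.sdiff_eq] at h; linarith
  have m3 : μ.real (D ∩ Jᶜ ∩ Wᶜ) = μ.real D - μ.real (D ∩ J) - μ.real (D ∩ W) + μ.real (D ∩ J ∩ W) := by
    have h1 := measureReal_inter_add_sdiff (μ := μ) (s := D ∩ Wᶜ) (hmeas J)
    have h2 := measureReal_inter_add_sdiff (μ := μ) (s := D) (hmeas W)
    rw [Set.sdiff_eq] at h1 h2
    have e1 : D ∩ Wᶜ ∩ J = D ∩ J ∩ Wᶜ := by ext ω; simp only [mem_inter_iff]; tauto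
    have e2 : D ∩ Wᶜ ∩ Jᶜ = D ∩ Jᶜ ∩ Wᶜ := by ext ω; simp only [mem_inter_iff]; tauto
    rw [e1, e2] at h1
    linarith [m1]
  rw [hJc, hWc]
  rw [show ({ω : BondConfig V | ∀ s ∈ S, ∀ t ∈ T, ¬ (openGraph ω).Reachable s t} ∩ J ∩ Wᶜ) = D ∩ J ∩ Wᶜ from rfl,
    show ({ω : BondConfig V | ∀ s ∈ S, ∀ t ∈ T, ¬ (openGraph ω).Reachable s t} ∩ Jᶜ) = D ∩ Jᶜ from rfl,
    show ({ω : BondConfig V | ∀ s ∈ S, ∀ t ∈ T, ¬ (openGraph ω).Reachable s t} ∩ J) = D ∩ J from rfl,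
    show ({ω : BondConfig V | ∀ s ∈ S, ∀ t ∈ T, ¬ (openGraph ω).Reachable s t} ∩ Jᶜ ∩ Wᶜ) = D ∩ Jᶜ ∩ Wᶜ from rfl]
  rw [m1, m2, m3]
  nlinarith [key, measureReal_nonneg (μ := μ) (s := D ∩ J), measureReal_nonneg (μ := μ) (s := D ∩ J ∩ W)]

end PcovBern

end

end Summit.CriticalPhenomena.PercolationContinuityZ3.Theorems
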